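import Mathlib
import Summits.CriticalPhenomena.PercolationContinuityZ3.Theorems.PercNearOneGluingNoHeavyLowerTailFatMinorityRestrictedLemma3
import Summits.CriticalPhenomena.PercolationContinuityZ3.Theorems.PercNearOneGluingNoHeavyLowerTailPureExchange
import HarnessLib

/-!
# `NoHeavyLowerTail` (stmt-CriticalPhenomena-4575), line fat-minority-linear — the PIVOTAL
# COMPARISON lemma (engine of the 'edge lemma' reduction, FINDINGS-fat-minority-gen8 §4b)

Route task `nh-dp-fatminority` (gen 8).  `μ = prodBernoulli w` on the pairs of `Fin n`.

For vertices `t, v, c, b` put `D = {v ↮ t}`.  Then, WHATEVER the sign of `μ(t ↔ b) − μ(v ↔ b)`,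

  `μ(D) · ( μ({t↔b} ∩ {v↮c} ∩ D) − μ({v↔b} ∩ {t↔c} ∩ D) ) ≥ ( μ(t↔b) − μ(v↔b) ) · μ({t↔c} ∩ D)`
                                                                            (`pivotalComparison`).

Meaning (gen 8, §4b): if `t` is the blob of the open ports of an observer `x` other than `v`, and
`e = {x, v}`, then `μ({t↔b} ∩ {v↮c} ∩ D) − μ({v↔b} ∩ {t↔c} ∩ D)` is exactly
`P(e pivotal for v↔b) − P(e pivotal for c↔b)` in that cell, so the lemma bounds the cell's
contribution to the EDGE LEMMA ('the edge to the least reliable port is more pivotal for that port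
than for any third vertex') below by the reliability gap `μ(t↔b) − μ(v↔b)` damped by
`κ = μ(t↔c | D) ∈ [0,1]`.  Proof: van den Berg–Häggström–Kahn Thm 1.5 for `(1{t↔b}, 1{v↮c})`
(`rl3_winner` with `E = univ`), Thm 1.4 for `(1{v↔b}, 1{t↔c})` (`knLemma3i_twoCluster`), and the
pointwise inclusion `{t↔c} ∩ D ⊆ {v↮c} ∩ D`.  No new definitions.
-/

namespace Summit.CriticalPhenomena.PercolationContinuityZ3.Theorems

open MeasureTheory Set
open Literature.Probability.LatticeModels (prodBernoulli)
open Literature.Probability.Percolation (BondConfig openConn openEdgeCluster)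

noncomputable section
open Classical
open Literature.Probability.LatticeModels Literature.Probability.Percolation

variable {n : ℕ}

/-- `{v ↮ c}` is decreasing and determined by the open edge cluster of `v` (in the encoding used
by `restrictedLemma3`). [folklore] -/
theorem pivotalComparison_notConn_downClosed (v c : Fin n) :
    ∀ ω ω' : BondConfig (Fin n), ω ∈ ((openConn v c)ᶜ : Set (BondConfig (Fin n))) →
      openEdgeCluster ω' v ⊆ openEdgeCluster ω v → ω' ∈ ((openConn v c)ᶜ : Set (BondConfig (Fin n))) := by
  intro ω ω' hω hsub hω'
  exact hω (pureExchange_Q_mono v c ω' ω hω' hsub)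

/-- **Pivotal comparison lemma.**  For vertices `t, v, c, b` and `D = {v ↮ t}`:
`μ(D) · (μ({t↔b} ∩ {v↮c} ∩ D) − μ({v↔b} ∩ {t↔c} ∩ D)) ≥ (μ(t↔b) − μ(v↔b)) · μ({t↔c} ∩ D)`,
for either sign of `μ(t↔b) − μ(v↔b)`.  Proof: BHK 2006 Thm 1.5 (`1{t↔b}` increasing in `C_t`,
`1{v↮c}` decreasing in `C_v`) gives `μ(D ∩ {t↔b}) μ(D ∩ {v↮c}) ≤ μ(D) μ(D ∩ {t↔b} ∩ {v↮c})`; Thm 1.4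
(`1{v↔b}`, `1{t↔c}`) gives `μ(D) μ(D ∩ {v↔b} ∩ {t↔c}) ≤ μ(D ∩ {v↔b}) μ(D ∩ {t↔c})`; on `D` the events
`{t↔c}` and `{v↔c}` are disjoint, so `μ(D ∩ {t↔c}) ≤ μ(D ∩ {v↮c})`; and
`μ(D ∩ {t↔b}) − μ(D ∩ {v↔b}) = μ(t↔b) − μ(v↔b)` (off `D` both events coincide).
[cite: VandenbergHaggstromKahn2005, Thm. 1.4 and Thm. 1.5 (p. 7); KozmaNitzan2024, Lemma 4 p. 9 (the qualitative two-endpoint form)] -/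
theorem pivotalComparison (w : Sym2 (Fin n) → unitInterval) (t v c b : Fin n) :
    ((prodBernoulli w).real (openConn t b) - (prodBernoulli w).real (openConn v b)) *
        (prodBernoulli w).real ((openConn v t)ᶜ ∩ openConn t c) ≤
      (prodBernoulli w).real (openConn v t)ᶜ *
        ((prodBernoulli w).real ((openConn v t)ᶜ ∩ (openConn t b ∩ (openConn v c)ᶜ)) -
          (prodBernoulli w).real ((openConn v t)ᶜ ∩ (openConn v b ∩ openConn t c))) := by
  set μ := prodBernoulli w with hμ
  rcases eq_or_ne v t with hvt | hvt
  · subst hvt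
    have hD : ((openConn v v)ᶜ : Set (BondConfig (Fin n))) = ∅ := by
      ext ω
      simp only [Set.mem_compl_iff, Set.mem_empty_iff_false, iff_false, not_not]
      exact SimpleGraph.Reachable.refl _
    simp [hD]
  have hDm : MeasurableSet ((openConn v t)ᶜ : Set (BondConfig (Fin n))) :=
    MeasurableSet.of_discrete
  -- (1) Thm 1.5 at the winner `t` with `E = univ`, `Q = {v ↮ c}` :
  --     μ(D' ∩ tb) μ(D' ∩ (univ ∩ {v↮c})) ≤ μ(D') μ(D' ∩ (tb ∩ (univ ∩ {v↮c}))),  D' = {t ↮ v}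
  have h1 := rl3_winner w t v b (Set.univ : Set (BondConfig (Fin n))) (openConn v c)ᶜ
    (fun ω ω' _ _ => Set.mem_univ ω') (pivotalComparison_notConn_downClosed v c) hvt.symm
  -- (2) Thm 1.4 for `1{v↔b}` (in `C_v`) and `Q = {t ↔ c}` (increasing in `C_t`), `D = {v ↮ t}`
  have h2 := knLemma3i_twoCluster w v t b (openConn t c : Set (BondConfig (Fin n)))
    (pureExchange_Q_mono t c) hvt
  have hcomm : ((openConn t v)ᶜ : Set (BondConfig (Fin n))) = (openConn v t)ᶜ := by
    ext ω
    simp only [Set.mem_compl_iff]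
    exact not_congr ⟨fun h => SimpleGraph.Reachable.symm h, fun h => SimpleGraph.Reachable.symm h⟩
  rw [hcomm] at h1
  simp only [Set.univ_inter] at h1
  -- (3) disjointness on `D`: `{t↔c} ∩ D ⊆ {v↮c} ∩ D`
  have hsub : ((openConn v t)ᶜ ∩ openConn t c : Set (BondConfig (Fin n))) ⊆
      (openConn v t)ᶜ ∩ (openConn v c)ᶜ := by
    rintro ω ⟨hD, htc⟩
    refine ⟨hD, fun hvc => hD ?_⟩
    exact SimpleGraph.Reachable.trans hvc (SimpleGraph.Reachable.symm htc)
  have h3 : μ.real ((openConn v t)ᶜ ∩ openConn t c) ≤ μ.real ((openConn v t)ᶜ ∩ (openConn v c)ᶜ) :=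
    measureReal_mono hsub
  -- (4) off `D` the events `{t↔b}` and `{v↔b}` coincide
  have hagree : (openConn t b : Set (BondConfig (Fin n))) \ (openConn v t)ᶜ =
      (openConn v b : Set (BondConfig (Fin n))) \ (openConn v t)ᶜ := by
    ext ω
    simp only [Set.mem_sdiff, Set.mem_compl_iff, not_not]
    constructor
    · rintro ⟨h1', h2'⟩
      exact ⟨SimpleGraph.Reachable.trans h2' h1', h2'⟩
    · rintro ⟨h1', h2'⟩
      exact ⟨SimpleGraph.Reachable.trans (SimpleGraph.Reachable.symm h2') h1', h2'⟩
  have hs1 := measureReal_inter_add_sdiff (μ := μ) (s := openConn t b) hDm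
  have hs2 := measureReal_inter_add_sdiff (μ := μ) (s := openConn v b) hDm
  rw [Set.inter_comm (openConn t b) (openConn v t)ᶜ] at hs1
  rw [Set.inter_comm (openConn v b) (openConn v t)ᶜ] at hs2
  have hdiff : μ.real (openConn t b) - μ.real (openConn v b) =
      μ.real ((openConn v t)ᶜ ∩ openConn t b) - μ.real ((openConn v t)ᶜ ∩ openConn v b) := by
    rw [hagree] at hs1
    linarith
  rw [hdiff]
  -- combine: with m = μ(D), xt = μ(D∩tb), xv = μ(D∩vb), q = μ(D∩{v↮c}), k = μ(D∩{t↔c}),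
  -- yt = μ(D∩tb∩{v↮c}), yv = μ(D∩vb∩{t↔c}):  xt q ≤ m yt,  m yv ≤ xv k,  k ≤ q.
  have hk : 0 ≤ μ.real ((openConn v t)ᶜ ∩ openConn t c) := measureReal_nonneg
  have hxt : 0 ≤ μ.real ((openConn v t)ᶜ ∩ openConn t b) := measureReal_nonneg
  nlinarith [h1, h2, h3, hk, hxt, mul_le_mul_of_nonneg_left h3 hxt]

end

end Summit.CriticalPhenomena.PercolationContinuityZ3.Theorems
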